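import Summits.BirchSwinnertonDyer.BirchSwinnertonDyer.Theorems.PrintCf2SplitBadTwoRestrictedSelmerCokernelBound
import Summits.BirchSwinnertonDyer.BirchSwinnertonDyer.Theorems.PrintCf2SplitBadTwoInertiaFixedTorsionSharp
import Literature.NumberTheory.GaloisRepresentations.AbsGaloisGroupCompact
import HarnessLib

/-!
# Crux `PrintCf2.SplitBadTwoRankOneOfFacts` (stmt-BirchSwinnertonDyer-20368), road α v10.2 — brick B15 file 1: the DICHOTOMY ENGINE for the
# local kernel of control at a place where the line RAMIFIES (`⊤`-currency of `relIndex_le_prod_natCard_localKer`):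
# `LK_w = 0` when `ker κ ⊓ D_w` acts trivially and `D_w − 1` is onto; `#LK_w ≤ #M^{ker κ ⊓ D_w}` when that fixed module is finite

Cell `bsd-print-cf2`, width seat `bsd-line-cf2-p1-w2` g9 (prover-bsd-line-cf2-p1-w2-g9-0); brick B15 = the DYADIC local kernel `LK_{v̄}` (LEAD g11
18:45:28Z; memo `Cruxes/SplitBadTwoRankOneOfFacts/B15-DYADIC-EXACT-w2g9.md`); `--supports stmt-BirchSwinnertonDyer-20368` (helper, Theses-free).
HONEST FRAMING: nothing here closes the crux or a registered stub; BSD is not proved by any of this; no summit statement is proved by this seat.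
No definition, no named fact, no `sorry`. Complements -w3 g7's p659525 (`#LK_w ≤ #M^{D_w}`, layer-`0` currency): that bound is `4` at `v̄` when
`W*(K_{v̄}) = ℤ/4`, whereas the true dyadic term is `0` or `1` (memo §3); the two theorems below are the UNCONDITIONAL halves of that dichotomy,
with the class-field-theoretic input isolated as a hypothesis on the subgroup `N := ker κ ⊓ D_w`.

WHAT (generic: `K` a number field, `κ` ANY `ℤ_p`-line, `M` a discrete `Γ_K`-module with continuous orbit maps, `w` ANY finite place,
`G₀ := ⊤ ⊓ D_w`, `N := ker κ ⊓ D_w ⊴ G₀`, `LK_w := ker (H¹(G₀, M) → H¹(N, M))` — the LEAD's local kernel, `D_w = GreenbergSelmer.decomp w`):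
* §1 `exists_topGenerator_of_continuous_padicInt` — a continuous `f : G → ℤ_p` on a COMPACT group is topologically cyclic modulo `ker f` (a value
  of minimal valuation generates: `f(U)` is compact and contains `ℤ·f(g₀)`, so `f(U) ⊇ f(g₀)ℤ_p ⊇ f(G)`); `exists_topGenerator_kerSubgroup_inf_decomp`
  — `G₀` is topologically generated by `N` and ONE element `g₀` (compactness of `D_w`; -w3's layer-`0` twin uses `exists_mem_localSubgroup_generate`);
  `localKer_top_le_subgroupResKer` — `LK_w` lies in the generic restriction kernel of `N.subgroupOf G₀`.
* §2 (a) **`localKer_top_eq_bot_of_smul_eq_of_surjective`** — if `N` acts TRIVIALLY on `M`, every `δ ∈ D_w` acting non-trivially has `δ − 1` ONTO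
  `M`, and `D_w` does act non-trivially, then `LK_w = ⊥`: `g₀` acts non-trivially (stabilisers are open and contain `N`, `g₀`), so
  `M^N/(g₀ − 1)M^N = M/(g₀ − 1)M = 0` and `LK_w ↪ 0` (`ResKernel.finite_subgroupResKer`).
  (b) **`finite_localKer_top_and_card_le_of_finite_fixed`** — if the `N`-fixed module `A := M^N` is FINITE, then `LK_w` is finite with `#LK_w ≤ #A`
  (`LK_w ↪ A/(g₀ − 1)A`).
ROAD α reading (memo §3, `M = W*`, `w = v̄`): with the CFT shape `ker κ' ⊓ D_{v̄} = χ^{−1}(±1)`, (a) is the case `−1 ∉ im χ` (`d ≡ 3 (8)` or `d ≡ 14 (16)`: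
`LK_{v̄} = 0`) and (b) with `A = W*[2]` the case `−1 ∈ im χ` (`#LK_{v̄} ≤ 2`); the `W*`-side inputs (cocyclic structure: `δ − 1` onto, `A ⊆ W*[2]`)
are file 2. presearch: Greenberg LNM 1716 §3 Lemmas 3.1–3.3 (pp. 85–88), Agboola 2007 §3 Prop. 3.2 — held; tree: p659525 (the `#M^{D_w}` bound),
p658116/p658559 (unramified/good places); no fact filed. beyond-print theorem: no.

References: [GreenbergLNM1716] §3 Lemmas 3.1–3.3 (pp. 85–88); [Agboola2007] §3 Prop. 3.2 (arXiv p0008:L128–135); [SerreGaloisCohomology1997]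
I §2.6; [NeukirchANT1999] Ch. II (9.6).
-/

noncomputable section

open scoped Classical

set_option linter.dupNamespace false
set_option autoImplicit false

open NumberField IsDedekindDomain Field WeierstrassCurve
open Literature.NumberTheory.EllipticCurves Literature.NumberTheory.EllipticCurves.GreenbergSelmer
open Literature.NumberTheory.EllipticCurves.Agboola2007
open Literature.NumberTheory.EllipticCurves.IwasawaDual
open Literature.NumberTheory.EllipticCurves.ResKernel
open Literature.NumberTheory.GaloisRepresentations
open IsDedekindDomain.HeightOneSpectrum

universe u

namespace Summit.BirchSwinnertonDyer.BirchSwinnertonDyer.Theorems.PrintCf2.RestrictedSelmerPair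

/-! ## §1. A continuous `ℤ_p`-valued homomorphism on a compact group is topologically cyclic modulo its kernel -/

section TopGen

variable {G : Type*} [Group G] [TopologicalSpace G] [IsTopologicalGroup G] [CompactSpace G]
  {p : ℕ} [Fact p.Prime]

/-- **A continuous homomorphism `f : G → ℤ_p` from a compact group is topologically cyclic modulo `ker f`**: some `g₀ ∈ G` (a value
of minimal valuation, so `f(G) ⊆ f(g₀)·ℤ_p`) lies in no proper OPEN subgroup containing `ker f` (`f(U)` is compact, hence closed, and
contains `ℤ·f(g₀)`; `U ⊇ ker f` is `f`-saturated) — the abstract form of "the decomposition group in a `ℤ_p`-extension is procyclic over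
its kernel" in Greenberg's Lemma 3.3. [cite: GreenbergLNM1716, §3 Lemma 3.3 (proof, pp. 86–88)] -/
theorem exists_topGenerator_of_continuous_padicInt (f : G →* Multiplicative ℤ_[p]) (hf : Continuous f) :
    ∃ g₀ : G, ∀ U : Subgroup G, IsOpen (U : Set G) → f.ker ≤ U → g₀ ∈ U → U = ⊤ := by
  by_cases htriv : ∀ g : G, (f g).toAdd = 0
  · refine ⟨1, fun U _ hker _ ↦ ?_⟩
    rw [eq_top_iff]
    intro x _
    refine hker ?_
    rw [MonoidHom.mem_ker, ← toAdd_eq_zero]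
    exact htriv x
  have hex : ∃ n : ℕ, ∃ g : G, (f g).toAdd ≠ 0 ∧ ((f g).toAdd).valuation = n := by
    obtain ⟨g, hg⟩ := not_forall.mp htriv
    exact ⟨_, g, hg, rfl⟩
  obtain ⟨g₀, hg₀, hval⟩ := Nat.find_spec hex
  have hmin : ∀ g : G, (f g).toAdd ≠ 0 → Nat.find hex ≤ ((f g).toAdd).valuation := fun g hg ↦
    Nat.find_min' hex ⟨g, hg, rfl⟩
  set a : ℤ_[p] := (f g₀).toAdd with ha_def
  -- every value of `f` is a `ℤ_p`-multiple of `a`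
  have hdvd : ∀ g : G, ∃ c : ℤ_[p], (f g).toAdd = a * c := by
    intro g
    by_cases hg : (f g).toAdd = 0
    · exact ⟨0, by rw [hg, mul_zero]⟩
    · have hmem : (f g).toAdd ∈ (Ideal.span {(p : ℤ_[p]) ^ Nat.find hex} : Ideal ℤ_[p]) :=
        (PadicInt.mem_span_pow_iff_le_valuation _ hg _).mpr (hmin g hg)
      obtain ⟨d, hd⟩ := Ideal.mem_span_singleton.mp hmem
      have hspec : a = (PadicInt.unitCoeff hg₀ : ℤ_[p]) * (p : ℤ_[p]) ^ Nat.find hex := by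
        rw [← hval]; exact PadicInt.unitCoeff_spec hg₀
      have hpm : (p : ℤ_[p]) ^ Nat.find hex = a * ((PadicInt.unitCoeff hg₀)⁻¹ : ℤ_[p]ˣ) := by
        rw [Units.eq_mul_inv_iff_mul_eq, mul_comm]; exact hspec.symm
      refine ⟨((PadicInt.unitCoeff hg₀)⁻¹ : ℤ_[p]ˣ) * d, ?_⟩
      rw [hd, ← mul_assoc, hpm]
  refine ⟨g₀, fun U hU hker hg₀U ↦ ?_⟩
  rw [eq_top_iff]
  intro x _
  -- the image of `U` under `toAdd ∘ f` is closed in `ℤ_p`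
  have hcf : Continuous fun u : G ↦ (f u).toAdd := continuous_toAdd.comp hf
  have hUc : IsClosed ((fun u : G ↦ (f u).toAdd) '' (U : Set G)) :=
    ((U.isClosed_of_isOpen hU).isCompact.image hcf).isClosed
  obtain ⟨c, hc⟩ := hdvd x
  -- `a * n ∈ image` for every integer `n`
  have hn : ∀ n : ℤ, a * (n : ℤ_[p]) ∈ (fun u : G ↦ (f u).toAdd) '' (U : Set G) := fun n ↦
    ⟨g₀ ^ n, U.zpow_mem hg₀U n, by
      show (f (g₀ ^ n)).toAdd = a * (n : ℤ_[p])
      rw [map_zpow, toAdd_zpow, zsmul_eq_mul, mul_comm]⟩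
  -- hence `a * c ∈ image` by density of `ℤ` in `ℤ_p`
  have hmemV : a * c ∈ (fun u : G ↦ (f u).toAdd) '' (U : Set G) := by
    have hc' : c ∈ closure (Set.range (Int.cast : ℤ → ℤ_[p])) := by
      rw [PadicInt.denseRange_intCast.closure_range]; exact Set.mem_univ c
    have hac : a * c ∈ closure ((fun t : ℤ_[p] ↦ a * t) '' Set.range (Int.cast : ℤ → ℤ_[p])) :=
      image_closure_subset_closure_image (continuous_const.mul continuous_id) ⟨c, hc', rfl⟩
    refine (hUc.closure_subset_iff.mpr ?_) hac
    rintro _ ⟨_, ⟨n, rfl⟩, rfl⟩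
    exact hn n
  obtain ⟨u, huU, hu⟩ := hmemV
  have hfx : f u = f x := Multiplicative.toAdd.injective (hu.trans hc.symm)
  have hux : u⁻¹ * x ∈ f.ker := by
    rw [MonoidHom.mem_ker, map_mul, map_inv, hfx, inv_mul_cancel]
  have h := U.mul_mem huU (hker hux)
  rwa [mul_inv_cancel_left] at h

end TopGen

/-! ## §2. The local kernel of control at an ARBITRARY finite place: `#LK_w ≤ #M^{D_w}` -/

section Generic

variable {K : Type u} [Field K] [NumberField K] {p : ℕ} [Fact p.Prime] (κ : ZpExtension K p)
  (M : Type u) [AddCommGroup M] [DistribMulAction (absoluteGaloisGroup K) M]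
  [TopologicalSpace M] [DiscreteTopology M] (w : HeightOneSpectrum (𝓞 K))

/-- The subgroup `⊤ ⊓ D_w` of `Γ_K` is compact (the decomposition group `D_w` is the continuous image of the compact `Γ_{K_w}`).
[cite: NeukirchANT1999, Ch. II §9 Prop. (9.6)] -/
theorem compactSpace_top_inf_decomp : CompactSpace ↥((⊤ : Subgroup (absoluteGaloisGroup K)) ⊓ decomp w) := by
  haveI : CompactSpace (absoluteGaloisGroup (w.adicCompletion K)) := absoluteGaloisGroup_compactSpace _
  have hD : IsCompact ((decomp w : Subgroup (absoluteGaloisGroup K)) : Set (absoluteGaloisGroup K)) :=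
    isCompact_range (absGaloisRestrict K (w.adicCompletion K)).continuous
  have hset : (((⊤ : Subgroup (absoluteGaloisGroup K)) ⊓ decomp w : Subgroup (absoluteGaloisGroup K)) :
      Set (absoluteGaloisGroup K)) = (decomp w : Set (absoluteGaloisGroup K)) := by
    rw [Subgroup.coe_inf, Subgroup.coe_top, Set.univ_inter]
  exact isCompact_iff_compactSpace.mp (hset ▸ hD)

/-- **`⊤ ⊓ D_w` is topologically generated by `ker κ ⊓ D_w` and ONE element**, for every `ℤ_p`-line `κ` and every finite place `w`
(ramified in the line or not): §1 applied to `κ` restricted to the compact `⊤ ⊓ D_w`.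
[cite: GreenbergLNM1716, §3 Lemma 3.3 (proof, pp. 86–88)] -/
theorem exists_topGenerator_kerSubgroup_inf_decomp :
    ∃ g₀ : ↥((⊤ : Subgroup (absoluteGaloisGroup K)) ⊓ decomp w),
      ∀ U : Subgroup ↥((⊤ : Subgroup (absoluteGaloisGroup K)) ⊓ decomp w),
        IsOpen (U : Set ↥((⊤ : Subgroup (absoluteGaloisGroup K)) ⊓ decomp w)) →
        (κ.kerSubgroup ⊓ decomp w).subgroupOf ((⊤ : Subgroup (absoluteGaloisGroup K)) ⊓ decomp w) ≤ U → g₀ ∈ U → U = ⊤ := by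
  haveI := compactSpace_top_inf_decomp (K := K) w
  let G₀ : Subgroup (absoluteGaloisGroup K) := ⊤ ⊓ decomp w
  let f : ↥G₀ →* Multiplicative ℤ_[p] := κ.toContinuousMonoidHom.toMonoidHom.comp G₀.subtype
  have hf : Continuous f := κ.toContinuousMonoidHom.continuous.comp continuous_subtype_val
  have hker : f.ker = (κ.kerSubgroup ⊓ decomp w).subgroupOf G₀ := by
    ext x
    rw [MonoidHom.mem_ker, Subgroup.mem_subgroupOf, Subgroup.mem_inf, ZpExtension.mem_kerSubgroup]
    exact ⟨fun h ↦ ⟨h, x.2.2⟩, fun h ↦ h.1⟩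
  obtain ⟨g₀, hg₀⟩ := exists_topGenerator_of_continuous_padicInt f hf
  exact ⟨g₀, fun U hU hN hg ↦ hg₀ U hU (hker ▸ hN) hg⟩

/-- `ker κ ⊓ D_w` is normal in `⊤ ⊓ D_w` (the target `ℤ_p` of `κ` is commutative). [folklore] -/
theorem normal_kerSubgroup_inf_decomp_subgroupOf_top :
    ((κ.kerSubgroup ⊓ decomp w).subgroupOf ((⊤ : Subgroup (absoluteGaloisGroup K)) ⊓ decomp w)).Normal := by
  refine ⟨fun n hn g ↦ ?_⟩
  rw [Subgroup.mem_subgroupOf, Subgroup.mem_inf] at hn ⊢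
  refine ⟨?_, (decomp w).mul_mem ((decomp w).mul_mem g.2.2 hn.2) ((decomp w).inv_mem g.2.2)⟩
  rw [ZpExtension.mem_kerSubgroup] at hn ⊢
  rw [Subgroup.coe_mul, Subgroup.coe_mul, Subgroup.coe_inv, map_mul, map_mul, map_inv, hn.1, mul_one, mul_inv_cancel]

/-- **`LK_w` lies in the restriction kernel of `N = ker κ ⊓ D_w` inside `G₀ = ⊤ ⊓ D_w`** (the generic `ResKernel.subgroupResKer` of
`N.subgroupOf G₀`): restriction along `↥N.subgroupOf G₀ ≅ ↥N` (functoriality `resH1Hom_comp`). [folklore] -/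
theorem localKer_top_le_subgroupResKer :
    (resOfLe M (inf_le_inf_right (decomp w) (le_top : κ.kerSubgroup ≤ ⊤) :
        κ.kerSubgroup ⊓ decomp w ≤ (⊤ : Subgroup (absoluteGaloisGroup K)) ⊓ decomp w)).ker ≤
      subgroupResKer M ((κ.kerSubgroup ⊓ decomp w).subgroupOf ((⊤ : Subgroup (absoluteGaloisGroup K)) ⊓ decomp w)) := by
  intro c hc
  let G₀ : Subgroup (absoluteGaloisGroup K) := ⊤ ⊓ decomp w
  let N : Subgroup ↥G₀ := (κ.kerSubgroup ⊓ decomp w).subgroupOf G₀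
  let j : ↥N →ₜ* ↥(κ.kerSubgroup ⊓ decomp w) :=
    { toFun := fun x ↦ ⟨((x : ↥G₀) : absoluteGaloisGroup K), Subgroup.mem_subgroupOf.mp x.2⟩
      map_one' := rfl
      map_mul' := fun _ _ ↦ rfl
      continuous_toFun := (continuous_subtype_val.comp continuous_subtype_val).subtype_mk _ }
  have hcomp : (resH1Hom j (AddMonoidHom.id M) (fun _ _ ↦ rfl)).comp
      (resOfLe M (inf_le_inf_right (decomp w) (le_top : κ.kerSubgroup ≤ ⊤) :
        κ.kerSubgroup ⊓ decomp w ≤ G₀)) = resSubgroup N M := by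
    unfold Literature.NumberTheory.EllipticCurves.resOfLe ResKernel.resSubgroup
    rw [resH1Hom_comp]
    exact resH1Hom_congr (ContinuousMonoidHom.ext fun _ ↦ rfl) (AddMonoidHom.ext fun _ ↦ rfl) _ _
  rw [mem_subgroupResKer_iff, ← hcomp, AddMonoidHom.comp_apply, (AddMonoidHom.mem_ker).mp hc, map_zero]

/-- The stabiliser argument: a point fixed by `N = ker κ ⊓ D_w` and by the topological generator `g₀` is fixed by all of `D_w` (its stabiliser
in `G₀` is an open subgroup containing `N` and `g₀`). [folklore] -/
theorem smul_eq_of_topGenerator (hcont : ∀ m : M, Continuous fun g : absoluteGaloisGroup K ↦ g • m)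
    {g₀ : ↥((⊤ : Subgroup (absoluteGaloisGroup K)) ⊓ decomp w)}
    (hgen : ∀ U : Subgroup ↥((⊤ : Subgroup (absoluteGaloisGroup K)) ⊓ decomp w),
        IsOpen (U : Set ↥((⊤ : Subgroup (absoluteGaloisGroup K)) ⊓ decomp w)) →
        (κ.kerSubgroup ⊓ decomp w).subgroupOf ((⊤ : Subgroup (absoluteGaloisGroup K)) ⊓ decomp w) ≤ U → g₀ ∈ U → U = ⊤)
    {a : M} (hNa : ∀ σ ∈ κ.kerSubgroup ⊓ decomp w, σ • a = a) (hga : g₀ • a = a) :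
    ∀ δ ∈ decomp w, δ • a = a := by
  intro δ hδ
  let G₀ : Subgroup (absoluteGaloisGroup K) := ⊤ ⊓ decomp w
  have hcont' : Continuous fun g : ↥G₀ ↦ g • a := (hcont a).comp continuous_subtype_val
  let S : Subgroup ↥G₀ := MulAction.stabilizer ↥G₀ a
  have hS : IsOpen (S : Set ↥G₀) := by
    have : (S : Set ↥G₀) = (fun g : ↥G₀ ↦ g • a) ⁻¹' {a} := by
      ext g; exact MulAction.mem_stabilizer_iff
    rw [this]
    exact hcont'.isOpen_preimage _ (isOpen_discrete _)
  have hNS : (κ.kerSubgroup ⊓ decomp w).subgroupOf G₀ ≤ S := fun n hn ↦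
    MulAction.mem_stabilizer_iff.mpr (hNa _ (Subgroup.mem_subgroupOf.mp hn))
  have htop := hgen S hS hNS (MulAction.mem_stabilizer_iff.mpr hga)
  have hmem : (⟨δ, Subgroup.mem_top δ, hδ⟩ : ↥G₀) ∈ S := htop ▸ Subgroup.mem_top _
  exact MulAction.mem_stabilizer_iff.mp hmem

/-- **(a) `LK_w = 0` WHEN `ker κ ⊓ D_w` ACTS TRIVIALLY AND `D_w − 1` IS ONTO.** `K` a number field, `κ` any `ℤ_p`-line, `M` a discrete
`Γ_K`-module with continuous orbit maps, `w` any finite place. If `N := ker κ ⊓ D_w` fixes `M` pointwise, every `δ ∈ D_w` moving some point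
of `M` has `m ↦ δ • m − m` SURJECTIVE on `M`, and some `δ ∈ D_w` moves some point, then the local kernel
`LK_w = ker (H¹(⊤ ⊓ D_w, M) → H¹(ker κ ⊓ D_w, M))` VANISHES: the topological generator `g₀` (§1) moves a point (else `D_w` would act trivially,
stabilisers being open), so `M^N/(g₀ − 1)M^N = 0` and `LK_w ↪ 0` (`ResKernel.finite_subgroupResKer`). Greenberg's "`H¹(Γ_v, M) = M/(γ_v − 1)M = 0`
for `M` divisible with `γ_v` acting by a non-trivial scalar". [cite: GreenbergLNM1716, §3 Lemma 3.1 and p. 87] [cite: Agboola2007, §3 Prop. 3.2] -/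
theorem localKer_top_eq_bot_of_smul_eq_of_surjective
    (hcont : ∀ m : M, Continuous fun g : absoluteGaloisGroup K ↦ g • m)
    (hN : ∀ σ ∈ κ.kerSubgroup ⊓ decomp w, ∀ m : M, σ • m = m)
    (hsurj : ∀ δ ∈ decomp w, (∃ m : M, δ • m ≠ m) → Function.Surjective fun m : M ↦ δ • m - m)
    (hne : ∃ δ ∈ decomp w, ∃ m : M, δ • m ≠ m) :
    (resOfLe M (inf_le_inf_right (decomp w) (le_top : κ.kerSubgroup ≤ ⊤))).ker = ⊥ := by
  let G₀ : Subgroup (absoluteGaloisGroup K) := ⊤ ⊓ decomp w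
  let N : Subgroup ↥G₀ := (κ.kerSubgroup ⊓ decomp w).subgroupOf G₀
  haveI : N.Normal := normal_kerSubgroup_inf_decomp_subgroupOf_top κ w
  obtain ⟨g₀, hgen⟩ := exists_topGenerator_kerSubgroup_inf_decomp κ w
  have hcont' : ∀ m : M, Continuous fun g : ↥G₀ ↦ g • m := fun m ↦ (hcont m).comp continuous_subtype_val
  -- `g₀` moves some point
  have hg₀ : ∃ m : M, (g₀ : absoluteGaloisGroup K) • m ≠ m := by
    by_contra h
    push Not at h
    obtain ⟨δ, hδ, m, hm⟩ := hne
    exact hm (smul_eq_of_topGenerator κ M w hcont hgen (fun σ hσ ↦ hN σ hσ m) (h m) δ hδ)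
  -- so `g₀ - 1` is onto `M = M^N`
  let A : AddSubgroup M := FixedPoints.addSubgroup ↥N M
  have hAtop : ∀ m : M, m ∈ A := fun m n ↦ hN _ (Subgroup.mem_subgroupOf.mp n.2) m
  have hrange : (subOne N M g₀).range = ⊤ := by
    rw [eq_top_iff]
    rintro a -
    obtain ⟨m, hm⟩ := hsurj (g₀ : absoluteGaloisGroup K) g₀.2.2 hg₀ (a : M)
    refine ⟨⟨m, hAtop m⟩, Subtype.ext ?_⟩
    rw [coe_subOne_apply]
    exact hm
  haveI : Subsingleton (↥A ⧸ (subOne N M g₀).range) := by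
    rw [hrange]; exact QuotientAddGroup.subsingleton_quotient_top
  haveI : Finite (↥A ⧸ (subOne N M g₀).range) := Finite.of_subsingleton
  obtain ⟨hfinK, hcardK⟩ := finite_subgroupResKer N M g₀ hgen hcont'
  haveI := hfinK
  have hcard1 : Nat.card (subgroupResKer M N) ≤ 1 := hcardK.trans (by rw [Nat.card_of_subsingleton (0 : ↥A ⧸ _)])
  haveI : Subsingleton (subgroupResKer M N) := Finite.card_le_one_iff_subsingleton.mp hcard1
  rw [eq_bot_iff]
  intro c hc
  have hmem : c ∈ subgroupResKer M N := localKer_top_le_subgroupResKer κ M w hc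
  have h0 : (⟨c, hmem⟩ : subgroupResKer M N) = ⟨0, AddSubgroup.zero_mem _⟩ := Subsingleton.elim _ _
  exact (AddSubgroup.mem_bot).mpr (congrArg Subtype.val h0)

/-- **(b) `#LK_w ≤ #M^{ker κ ⊓ D_w}` WHEN THAT FIXED MODULE IS FINITE.** Same generic setting: if the set of points of `M` fixed by `N = ker κ ⊓ D_w`
is FINITE, the local kernel `LK_w` is finite with `#LK_w ≤ #{m | N fixes m}` (`LK_w ↪ A/(g₀ − 1)A`, `#A/(g₀ − 1)A ≤ #A`). For `M = W*` at `v̄` with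
`A = W*[2]` this is the dyadic unit `v₂ #LK_{v̄} ≤ 1`. [cite: GreenbergLNM1716, §3 Lemma 3.1 (p. 86)] [cite: Agboola2007, §3 Prop. 3.2] -/
theorem finite_localKer_top_and_card_le_of_finite_fixed
    (hcont : ∀ m : M, Continuous fun g : absoluteGaloisGroup K ↦ g • m)
    (hA : Set.Finite {m : M | ∀ σ ∈ κ.kerSubgroup ⊓ decomp w, σ • m = m}) :
    Finite (resOfLe M (inf_le_inf_right (decomp w) (le_top : κ.kerSubgroup ≤ ⊤))).ker ∧
      Nat.card (resOfLe M (inf_le_inf_right (decomp w) (le_top : κ.kerSubgroup ≤ ⊤))).ker ≤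
        Nat.card {m : M | ∀ σ ∈ κ.kerSubgroup ⊓ decomp w, σ • m = m} := by
  let G₀ : Subgroup (absoluteGaloisGroup K) := ⊤ ⊓ decomp w
  let N : Subgroup ↥G₀ := (κ.kerSubgroup ⊓ decomp w).subgroupOf G₀
  haveI : N.Normal := normal_kerSubgroup_inf_decomp_subgroupOf_top κ w
  obtain ⟨g₀, hgen⟩ := exists_topGenerator_kerSubgroup_inf_decomp κ w
  have hcont' : ∀ m : M, Continuous fun g : ↥G₀ ↦ g • m := fun m ↦ (hcont m).comp continuous_subtype_val
  let A : AddSubgroup M := FixedPoints.addSubgroup ↥N M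
  -- `A ≃ {m | N fixes m}`
  have hmemA : ∀ m : M, m ∈ A ↔ ∀ σ ∈ κ.kerSubgroup ⊓ decomp w, σ • m = m := by
    intro m
    rw [FixedPoints.mem_addSubgroup]
    constructor
    · intro h σ hσ
      exact h ⟨⟨σ, Subgroup.mem_top σ, hσ.2⟩, Subgroup.mem_subgroupOf.mpr hσ⟩
    · rintro h ⟨n, hn⟩
      exact h _ (Subgroup.mem_subgroupOf.mp hn)
  let e : ↥A ≃ {m : M | ∀ σ ∈ κ.kerSubgroup ⊓ decomp w, σ • m = m} :=
    { toFun := fun a ↦ ⟨(a : M), (hmemA _).mp a.2⟩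
      invFun := fun m ↦ ⟨(m : M), (hmemA _).mpr m.2⟩
      left_inv := fun a ↦ rfl
      right_inv := fun m ↦ rfl }
  haveI : Finite {m : M | ∀ σ ∈ κ.kerSubgroup ⊓ decomp w, σ • m = m} := hA.to_subtype
  haveI : Finite ↥A := Finite.of_equiv _ e.symm
  haveI : Finite (↥A ⧸ (subOne N M g₀).range) := inferInstance
  obtain ⟨hfinK, hcardK⟩ := finite_subgroupResKer N M g₀ hgen hcont'
  haveI := hfinK
  let ι : (resOfLe M (inf_le_inf_right (decomp w) (le_top : κ.kerSubgroup ≤ ⊤) : κ.kerSubgroup ⊓ decomp w ≤ G₀)).ker →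
      subgroupResKer M N := fun c ↦ ⟨(c : subgroupH1 G₀ M), localKer_top_le_subgroupResKer κ M w c.2⟩
  have hι : Function.Injective ι := by
    intro x y hxy
    apply Subtype.ext
    exact congrArg (fun z : subgroupResKer M N ↦ (z : subgroupH1 G₀ M)) hxy
  refine ⟨Finite.of_injective ι hι, (Nat.card_le_card_of_injective ι hι).trans (hcardK.trans ?_)⟩
  calc Nat.card (↥A ⧸ (subOne N M g₀).range) ≤ Nat.card ↥A := natCard_quotient_le _
    _ = Nat.card {m : M | ∀ σ ∈ κ.kerSubgroup ⊓ decomp w, σ • m = m} := Nat.card_congr e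

end Generic

end Summit.BirchSwinnertonDyer.BirchSwinnertonDyer.Theorems.PrintCf2.RestrictedSelmerPair

end
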